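import Mathlib
import Summits.Ventures.PercRepro2.Defs
import Summits.Ventures.PercRepro2.Graph
import Summits.Ventures.PercRepro2.OneColourSwitch
import Summits.Ventures.PercRepro2.RegionHubSign
import Summits.Ventures.PercRepro2.SideSwitch
import Summits.Ventures.PercRepro2.SideSwitchFibre
import Summits.Ventures.PercRepro2.SideSwitchClosed
import Summits.Ventures.PercRepro2.SideSwitchComps
import Summits.Ventures.PercRepro2.SideSwitchCompsFibre
import Summits.Ventures.PercRepro2.TermSwitchDefs
import Summits.Ventures.PercRepro2.TermSwitchFibre
import Summits.Ventures.PercRepro2.TermSwitchCompsFibre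
import Summits.Ventures.PercRepro2.TermSwitchMono
import Summits.Ventures.PercRepro2.TermSwitchM9
import Summits.Ventures.PercRepro2.TermSwitchRestrict
import Summits.Ventures.PercRepro2.TermSwitchReach
import Summits.Ventures.PercRepro2.TermSwitchHalfCube
import Summits.Ventures.PercRepro2.M9NoPocketDefs
import Summits.Ventures.PercRepro2.M9NoPocketWorld
import Summits.Ventures.PercRepro2.M9NoPocketWorldD
import Summits.Ventures.PercRepro2.M9NoPocketFibre
import Summits.Ventures.PercRepro2.M9PocketUnit
import Summits.Ventures.PercRepro2.M9PocketUnitSum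
import Summits.Ventures.PercRepro2.M9PocketUnitPred

/-!
# The half-cube theorem inside a unit (blind cell PercRepro2, p3 g38, 2026-08-29;
`proofs/P3-POCKETRK.md` §8‴)

The half-cube theorem of `TermSwitchHalfCube` applied to the fibre-invariant predicate
«`d` reached, in the unit of `ρ₀`, and `F (K_H ∪ M_H) (K₂ ∪ M₂ of G − d)`» of
`M9PocketUnitPred`: for every colouring `ρ₀`, every world-set predicate `F` and every vertex
`x₀`, `Σ_{ω ∈ Sep₃ ∩ DZero₃, d reached, ω in the unit of ρ₀, F, x₀ ∈ K_H(ω)} σ_pq(ω) ≤ 0`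
(`dzeroSigmaSumHP_unit_KH_nonpos`).  With `x₀` a vertex of the linking free block `B*` of
§8″ this is the `Y`-co-fibre part of the `L`-class of the unit restricted to `P₁` or `¬P₁`
(the linking-free-block assembly for `s(𝔑) = 0`: §8‴).  Own work; std axioms.
-/

namespace Summit.Ventures.PercRepro2

namespace NoPocket

open Finset Classical RegionHub OneColourSwitch SideSwitch TermSwitch

variable {V : Type*} {E : Type*}

section Fibre

variable [Fintype V] [DecidableEq V] [Fintype E] [DecidableEq E] {ends : E → Sym2 V}
  {p q r s d : V}

/-- **The half-cube theorem inside a unit**: for every `ρ₀`, every world-set predicate `F` and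
every vertex `x₀`, the sum of `σ_pq` over the `L`-class of the unit of `ρ₀` restricted by `F`
and by «`x₀ ∈ K_H`» is non-positive. -/
theorem dzeroSigmaSumHP_unit_KH_nonpos (p q : V) (hrd : r ≠ d) (hsd : s ≠ d) (ρ₀ : Config E)
    (F : Set V → Set V → Prop) (x₀ : V) :
    (∑ ω : Config E, if sepH ends p q ({r, s, d} : Set V) ω ∧ DZeroH ends ({r, s, d} : Set V) ω ∧
      (Reached ends r s d ω ∧
        (∀ e ∈ touches (endsD ends d) (K2 (endsD ends d) r s ω ∪ M2 (endsD ends d) r s ω),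
          nu (endsD ends d) r s ω e = ρ₀ e) ∧
        F (KH ends ({r, s, d} : Set V) ω ∪ MH ends ({r, s, d} : Set V) ω)
          (K2 (endsD ends d) r s ω ∪ M2 (endsD ends d) r s ω)) ∧
      x₀ ∈ KH ends ({r, s, d} : Set V) ω then sigma ends ω p q else 0) ≤ 0 := by
  have h := dzeroSigmaSumHP_KH_nonpos (ends := ends) p q ({r, s, d} : Set V)
    (fun ω => Reached ends r s d ω ∧
      (∀ e ∈ touches (endsD ends d) (K2 (endsD ends d) r s ω ∪ M2 (endsD ends d) r s ω),
        nu (endsD ends d) r s ω e = ρ₀ e) ∧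
      F (KH ends ({r, s, d} : Set V) ω ∪ MH ends ({r, s, d} : Set V) ω)
        (K2 (endsD ends d) r s ω ∪ M2 (endsD ends d) r s ω))
    (fun _ hρ _ hT => and_congr (reached_assignC_iff hrd hsd hT)
      (and_congr (unit_assignC_iff hrd.symm hsd.symm ρ₀ hρ hT)
        (worldPred_assignC_iff F hrd.symm hsd.symm hρ hT)))
    (fun ρ hρ => and_congr (reached_flipOH_iff ρ)
      (and_congr (unit_flipOH_iff hrd.symm hsd.symm ρ₀ hρ)
        (worldPred_flipOH_iff F hrd.symm hsd.symm ρ)))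
    x₀
  refine le_of_eq_of_le (Finset.sum_congr rfl (fun ω _ => ?_)) h
  split_ifs <;> rfl

/-- The instance for the predicate `P₁` of §8″ («the `{r, s, d}`-component of the block `C₀`
meets a vertex reached only through `d`») and a vertex `x₀` (of `C₀`): the `Y`-co-fibre part of
the `L`-class of the unit restricted to `P₁`. -/
theorem dzeroSigmaSumHP_unit_componentTouch_KH_nonpos (p q : V) (hrd : r ≠ d) (hsd : s ≠ d)
    (ρ₀ : Config E) (C₀ : Set V) (x₀ : V) :
    (∑ ω : Config E, if sepH ends p q ({r, s, d} : Set V) ω ∧ DZeroH ends ({r, s, d} : Set V) ω ∧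
      (Reached ends r s d ω ∧
        (∀ e ∈ touches (endsD ends d) (K2 (endsD ends d) r s ω ∪ M2 (endsD ends d) r s ω),
          nu (endsD ends d) r s ω e = ρ₀ e) ∧
        ∃ x ∈ C₀, ∃ e, ∃ y, ends e = s(x, y) ∧
          y ∈ KH ends ({r, s, d} : Set V) ω ∪ MH ends ({r, s, d} : Set V) ω ∧
          y ∉ ({r, s, d} : Set V) ∧
          y ∉ K2 (endsD ends d) r s ω ∪ M2 (endsD ends d) r s ω) ∧
      x₀ ∈ KH ends ({r, s, d} : Set V) ω then sigma ends ω p q else 0) ≤ 0 := by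
  have h := dzeroSigmaSumHP_unit_KH_nonpos (ends := ends) p q hrd hsd ρ₀
    (fun UH U2 => ∃ x ∈ C₀, ∃ e, ∃ y, ends e = s(x, y) ∧ y ∈ UH ∧ y ∉ ({r, s, d} : Set V) ∧
      y ∉ U2) x₀
  refine le_of_eq_of_le (Finset.sum_congr rfl (fun ω _ => ?_)) h
  split_ifs <;> rfl

end Fibre

end NoPocket

end Summit.Ventures.PercRepro2
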